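import Summits.CriticalPhenomena.PercolationContinuityZ3.Theorems.PercNearOneGluingNoHeavyRsw3SlabSealedRegions
import Summits.CriticalPhenomena.PercolationContinuityZ3.Theorems.PercNearOneGluingNoHeavyRsw3AnnulusTwoArmSeparation
import HarnessLib

/-!
# RSW3 lane (P2, gen 9): WALLS OF BLOCKED ANNULI SEAL A SLAB REGION — the deterministic confinement lemma

builds on p205010 (kernel theorem, internal audit signed; external expert review pending)

Cell `prim-rsw3`, prover seat `prim-rsw3-p2` (gen 9), memo `run/shared/lean/prim/rsw3/P2-RSWLITE.md` §15.
Support file (`--supports stmt-CriticalPhenomena-4575`); no definitions, no named facts, no sorries.  Deterministic core of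
`…Rsw3SlabManyClusters` (many spanning clusters in thin slab-boxes of `ℤ³` under `X_B`).

`sealed_of_walls`.  Inside the slab `{0..n} × {0..M}²` fix a region `[α, α + 2n] × [0, 2n]` (lateral coordinates `x₁, x₂`)
and surround it, at distance `g = 2r + 1 ≥ n - 1`, by three WALLS: the plane pieces `{x₁ = α - g}`, `{x₁ = α + 2n + g}`,
`{x₂ = 2n + g}`, each covered by the `64` boxes `Λ_Z(r)` of a grid of pitch `g` (centres `Z(t, j)`, `t ∈ {0,1,2}`,
`j ∈ {0..7}²`).  If NONE of the `192` aspect-2 annuli `Λ_Z(r) ↔ ∂ⁱⁿΛ_Z(2r)` is crossed by an open path, then every vertex joined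
inside the slab to the region lies in the box `{α - 2g < x₁ < α + 2n + 7g, x₂ < 2n + 8g}`: an open path leaving
`{α - g < x₁ < α + 2n + g, x₂ < 2n + g}` steps onto one of the three planes (`Rsw3.exit_plane_cases`) at a site of some
`Λ_Z(r)` (`Rsw3.gridIdx_coord_bounds`), and to leave the big box it must leave `Λ_Z(2r)`, realising that annulus crossing
(`Rsw3.mem_annCrossAt_of_reachable`).  Helpers: `mem_Icc_zero_iff_forall`, `forall_fin_three`.

References: M. Aizenman, Nucl. Phys. B 485 (1997) 551–582, §2 (renormalisation cells in slabs) [Aizenman1997]; G. Grimmett,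
*Percolation* (1999), §1.6, §7.2 (block arguments) [GrimmettPercolation1999]. [folklore]
-/

noncomputable section

namespace Summit.CriticalPhenomena.PercolationContinuityZ3.Theorems

open MeasureTheory ProbabilityTheory Filter Topology
open Literature.Probability.Percolation Literature.Probability.LatticeModels
open Literature.Barriers.CriticalPhenomena

namespace Rsw3

open SurfaceTension Crossing

/-- Membership in the block `{0..L}` of `ℤ³`, coordinatewise. [folklore] -/
theorem mem_Icc_zero_iff_forall {L y : Site 3} : y ∈ Finset.Icc (0 : Site 3) L ↔ ∀ j, 0 ≤ y j ∧ y j ≤ L j := by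
  rw [Finset.mem_Icc, Pi.le_def, Pi.le_def]
  exact ⟨fun h j => ⟨h.1 j, h.2 j⟩, fun h => ⟨fun j => (h j).1, fun j => (h j).2⟩⟩

/-- `∀ k : Fin 3, P k` unfolded. [folklore] -/
theorem forall_fin_three {P : Fin 3 → Prop} : (∀ k, P k) ↔ P 0 ∧ P 1 ∧ P 2 :=
  ⟨fun h => ⟨h 0, h 1, h 2⟩, fun h k => by
    match k with
    | ⟨0, _⟩ => exact h.1
    | ⟨1, _⟩ => exact h.2.1
    | ⟨2, _⟩ => exact h.2.2⟩

/-- **SEALING BY THREE WALLS OF BLOCKED ANNULI.**  Fix `n`, `r ≥ 1`, `g = 2r + 1 ≥ n - 1`, a lateral position `α`, and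
the `192` wall centres `Z(t, j)` (`t ∈ {0,1,2}`, `j ∈ {0..7}²`): `Z(0,j) = (g j₁, α - g, g j₂)` and `Z(1,j) = (g j₁, α + 2n + g, g j₂)`
on the side planes, `Z(2,j) = (g j₁, α - g + g j₂, 2n + g)` on the top plane.  If none of the annuli
`Λ_{Z(t,j)}(r) ↔ ∂ⁱⁿΛ_{Z(t,j)}(2r)` is crossed, then every vertex joined inside the slab `{0..n} × {0..M}²` to a vertex `x` of the
region `[α, α + 2n] × [0, 2n]` (lateral coordinates) satisfies `α - 2g < y₁ < α + 2n + 7g` and `y₂ < 2n + 8g`: an open path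
leaving the box `{α - g < x₁ < α + 2n + g, x₂ < 2n + g}` steps onto one of the three planes at a site of some `Λ_Z(r)`
(`Rsw3.exit_plane_cases`, `Rsw3.gridIdx_coord_bounds`) and, to leave the big box, must leave `Λ_Z(2r)` — realising that
annulus crossing (`Rsw3.mem_annCrossAt_of_reachable`). [folklore] -/
theorem sealed_of_walls {n r M : ℕ} {g α : ℤ} (hg : g = 2 * (r : ℤ) + 1) (hr1 : 1 ≤ r) (hgn : (n : ℤ) ≤ g + 1)
    (Z : Fin 3 × (ℤ × ℤ) → Site 3) (hZ0 : ∀ q, Z q 0 = g * q.2.1)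
    (hZ1 : ∀ q, Z q 1 = if q.1 = 2 then α - g + g * q.2.2 else if q.1 = 0 then α - g else α + 2 * n + g)
    (hZ2 : ∀ q, Z q 2 = if q.1 = 2 then 2 * n + g else g * q.2.2)
    {ω : BondConfig (Site 3)}
    (hW : ∀ q ∈ (Finset.univ : Finset (Fin 3)) ×ˢ (Finset.Icc (0 : ℤ) 7 ×ˢ Finset.Icc (0 : ℤ) 7),
      ω ∉ linked (sbox (Z q) (2 * r)) ((zdShiftIso (Z q)) '' ↑(innerBoundary (zdGraph 3) (box 3 (2 * r))))
        (sbox (Z q) r))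
    {x y : Site 3} (hx : α ≤ x 1 ∧ x 1 ≤ α + 2 * n ∧ 0 ≤ x 2 ∧ x 2 ≤ 2 * n)
    (hxy : (openGraph ω ⊓ withinGraph (zdGraph 3)
      (↑(Finset.Icc (0 : Site 3) ![(n : ℤ), M, M]) : Set (Site 3))).Reachable x y) :
    α - 2 * g < y 1 ∧ y 1 < α + 2 * n + 7 * g ∧ y 2 < 2 * n + 8 * g := by
  by_contra hyBox
  have hn0 : (0 : ℤ) ≤ n := by positivity
  have hr1z : (1 : ℤ) ≤ r := by exact_mod_cast hr1
  have hg3 : 3 ≤ g := by rw [hg]; omega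
  set B : Set (Site 3) := {z | α - g < z 1 ∧ z 1 < α + 2 * n + g ∧ z 2 < 2 * n + g} with hB
  obtain ⟨hx1, hx1', hx2, hx2'⟩ := hx
  have hxB : x ∈ B := ⟨by linarith, by linarith, by linarith⟩
  have hyB : y ∉ B := fun h => hyBox ⟨by linarith [h.1], by linarith [h.2.1], by linarith [h.2.2]⟩
  obtain ⟨Wk⟩ := hxy
  obtain ⟨b, c, hb, hc, hadj, hcy⟩ := exists_exit_adj_reachable B Wk hxB hyB
  obtain ⟨-, hwithin⟩ := (SimpleGraph.inf_adj _ _ _ _).1 hadj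
  rw [withinGraph_adj] at hwithin
  have hcS := mem_Icc_zero_iff_forall.1 (Finset.mem_coe.1 hwithin.2.2)
  have hc00 : 0 ≤ c 0 := (hcS 0).1
  have hc0n : c 0 ≤ n := by simpa using (hcS 0).2
  have hc2 : 0 ≤ c 2 := (hcS 2).1
  have hcases := exit_plane_cases (α := α - g) (β := α + 2 * n + g) (γ := 2 * n + g) hb hc hwithin.1
  have hcy' : (openGraph ω ⊓ zdGraph 3).Reachable c y := hcy.mono (inf_le_inf_left _ (withinGraph_le _ _))
  have hg' : (2 * (r : ℤ) + 1) = g := hg.symm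
  obtain ⟨hj0lo, hj0hi, hj0a, hj0b⟩ := gridIdx_coord_bounds (r := r) (t := c 0) hc00 (by rw [hg']; linarith)
  rw [hg'] at hj0lo hj0hi hj0a hj0b
  have hyBox' : ¬ (α - 2 * g < y 1 ∧ y 1 < α + 2 * n + 7 * g ∧ y 2 < 2 * n + 8 * g) := hyBox
  -- the wall through which the path leaves, and the annulus it would have to cross
  obtain ⟨q, hq, hcin, hyout⟩ : ∃ q ∈ (Finset.univ : Finset (Fin 3)) ×ˢ (Finset.Icc (0 : ℤ) 7 ×ˢ Finset.Icc (0 : ℤ) 7),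
      c ∈ sbox (Z q) r ∧ y ∉ sbox (Z q) (2 * r) := by
    obtain ⟨hc0b, hcase⟩ := hcases
    rcases hcase with ⟨h1, h2⟩ | ⟨h2, h1⟩
    · -- a side wall: grid on `(x₀, x₂)`
      have hc2' : c 2 < 2 * n + g := by rw [h2]; exact hb.2.2
      obtain ⟨hj2lo, hj2hi, hj2a, hj2b⟩ :=
        gridIdx_coord_bounds (r := r) (t := c 2) hc2 (by rw [hg']; linarith)
      rw [hg'] at hj2lo hj2hi hj2a hj2b
      rcases h1 with h1 | h1
      · refine ⟨((0 : Fin 3), ((c 0 + r) / g, (c 2 + r) / g)), ?_, ?_, ?_⟩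
        · simp only [Finset.mem_product, Finset.mem_univ, Finset.mem_Icc, true_and]
          exact ⟨⟨hj0lo, hj0hi⟩, ⟨hj2lo, hj2hi⟩⟩
        · rw [mem_sbox_iff, forall_fin_three, hZ0, hZ1, hZ2]
          simp only [Fin.isValue, Fin.reduceEq, ↓reduceIte]
          rw [h1]
          refine ⟨⟨?_, ?_⟩, ⟨?_, ?_⟩, ⟨?_, ?_⟩⟩ <;> linarith
        · intro hy'
          have hk1 := (mem_sbox_iff.1 hy') 1
          have hk2 := (mem_sbox_iff.1 hy') 2
          rw [hZ1] at hk1; rw [hZ2] at hk2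
          simp only [Fin.isValue, Fin.reduceEq, ↓reduceIte] at hk1 hk2
          push_cast at hk1 hk2
          apply hyBox'
          refine ⟨by linarith, by linarith, by nlinarith⟩
      · refine ⟨((1 : Fin 3), ((c 0 + r) / g, (c 2 + r) / g)), ?_, ?_, ?_⟩
        · simp only [Finset.mem_product, Finset.mem_univ, Finset.mem_Icc, true_and]
          exact ⟨⟨hj0lo, hj0hi⟩, ⟨hj2lo, hj2hi⟩⟩
        · rw [mem_sbox_iff, forall_fin_three, hZ0, hZ1, hZ2]
          simp only [Fin.isValue, Fin.reduceEq, ↓reduceIte, one_ne_zero]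
          rw [h1]
          refine ⟨⟨?_, ?_⟩, ⟨?_, ?_⟩, ⟨?_, ?_⟩⟩ <;> linarith
        · intro hy'
          have hk1 := (mem_sbox_iff.1 hy') 1
          have hk2 := (mem_sbox_iff.1 hy') 2
          rw [hZ1] at hk1; rw [hZ2] at hk2
          simp only [Fin.isValue, Fin.reduceEq, ↓reduceIte, one_ne_zero] at hk1 hk2
          push_cast at hk1 hk2
          apply hyBox'
          refine ⟨by linarith, by linarith, by nlinarith⟩
    · -- the top wall: grid on `(x₀, x₁ - (α - g))`
      have hc1lo : α - g < c 1 := by rw [h1]; exact hb.1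
      have hc1hi : c 1 < α + 2 * n + g := by rw [h1]; exact hb.2.1
      obtain ⟨hj1lo, hj1hi, hj1a, hj1b⟩ :=
        gridIdx_coord_bounds (r := r) (t := c 1 - (α - g)) (by linarith) (by rw [hg']; linarith)
      rw [hg'] at hj1lo hj1hi hj1a hj1b
      refine ⟨((2 : Fin 3), ((c 0 + r) / g, (c 1 - (α - g) + r) / g)), ?_, ?_, ?_⟩
      · simp only [Finset.mem_product, Finset.mem_univ, Finset.mem_Icc, true_and]
        exact ⟨⟨hj0lo, hj0hi⟩, ⟨hj1lo, hj1hi⟩⟩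
      · rw [mem_sbox_iff, forall_fin_three, hZ0, hZ1, hZ2]
        simp only [Fin.isValue, ↓reduceIte]
        rw [h2]
        refine ⟨⟨?_, ?_⟩, ⟨?_, ?_⟩, ⟨?_, ?_⟩⟩ <;> linarith
      · intro hy'
        have hk1 := (mem_sbox_iff.1 hy') 1
        have hk2 := (mem_sbox_iff.1 hy') 2
        rw [hZ1] at hk1; rw [hZ2] at hk2
        simp only [Fin.isValue, ↓reduceIte] at hk1 hk2
        push_cast at hk1 hk2
        apply hyBox'
        refine ⟨by nlinarith, by nlinarith, by linarith⟩
  have hcross := mem_annCrossAt_of_reachable (by omega : r ≤ 2 * r) hcin hyout hcy'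
  exact hW q hq hcross


end Rsw3

end Summit.CriticalPhenomena.PercolationContinuityZ3.Theorems

end
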